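import Literature.Analysis.FunctionSpaces.SpinorWightmanPCTCovariance
import Literature.Analysis.FunctionSpaces.SpinorWightmanPCTKinematics
import Literature.Analysis.FunctionSpaces.SpinorWightmanPCTLocality
import Literature.MathematicalPhysics.QuantumLattice.TubeNegRev
import HarnessLib

/-!
# The PCT identity for the holomorphic Wightman functions and the Wightman distributions of a
spinor theory

Topic `Literature/Analysis/FunctionSpaces`. The assembly of Streater–Wightman's Thm. 4-7 (1964, §4-3)
for a spinor theory `IsSpinorWightmanQFT W` and a species sequence `k : Fin n → κ`, from the
function-theoretic core `TubeBoost.pct_core_local` (`TubeBoostPCT`) fed with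

* `F = hW.wRelFn k`, the holomorphic Wightman function of `φ_{k₀} ⋯ φ_{k_{n−1}}` on `𝒯ʳₙ`
  (`SpinorWightmanPCTCovariance`), boost covariant with the continued boosts `boostGroup` and rotation
  covariant with `rotTensor` (`SpinorWightmanPCTKinematics`, through the cover
  `Λ(diag(e^{χ/2}, e^{−χ/2})) = B₃(χ)`, `Λ(A_R) = R`);
* `H = hW.pctH k`, `H(z)_α = 𝒲_{k∘rev}(negRev z)_{α∘rev}`, the holomorphic Wightman function of the
  reversed sequence at `(−z_{n−1}, …, −z₀)` (`TubeNegRev`), with boundary value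
  `hW.pctDist k α = 𝒲_{k∘rev, α∘rev} ∘ negRevTest`, i.e. `⟪Ω, φ_{k_{n−1}α_{n−1}}(−x_{n−1}) ⋯ φ_{k₀α₀}(−x₀) Ω⟫`;
* weak local commutativity on a box of right-wedge configurations (`SpinorWightmanPCTLocality`):
  `𝒲_{k,α}(φ(−·)) = σ 𝒲^{PCT}_{k,α}(φ)`, `σ = fermiPairSign` of the flags of `k`.

Results:

* `IsSpinorWightmanQFT.wRelFn_eq_pct` — **the PCT identity of the holomorphic functions** on `𝒯ₙ`:
  `𝒲_k(z) = σ · (⊗ⱼ (Cⱼ Sⱼ(−1))) 𝒲^{PCT}_k(z)` with `Cⱼ = SL2C.pctMatrix (S (k j))`;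
* `IsSpinorWightmanQFT.wDist_eq_pct` — **the PCT identity of the distributions**:
  `𝒲_{k,α} = σ ∑_β (⊗ⱼ Cⱼ)_{αβ} 𝒲^{PCT}_{k,β}` (the factor `⊗ Sⱼ(−1)` acts trivially: a rotation by `2π`);
* `IsSpinorWightmanQFT.wightmanFn_eq_pct` — on tensor products:
  `𝒲_{k,α}(f) = σ ∑_β ∏ⱼ Cⱼ(αⱼ, βⱼ) · 𝒲_{k∘rev, β∘rev}(f̂ ∘ rev)`, `f̂(x) = f(−x)` — the PCT
  condition of `pct_theorem` up to the identification `σ = i^F` (valid when `F` is even).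

## References

* R. F. Streater, A. S. Wightman, *PCT, Spin and Statistics, and All That* (1964; Princeton 2000),
  §4-3 Thm. 4-7, eqs. (4-19), (4-29)–(4-35). [StreaterWightman1964]
-/

noncomputable section

open Filter MeasureTheory Set ComplexConjugate Complex
open _root_.Topology
open scoped InnerProductSpace SchwartzMap MatrixGroups Real
open Literature.MathematicalPhysics Literature.MathematicalPhysics.QuantumLattice

namespace Literature.Analysis.FunctionSpaces

variable {κ : Type*}

namespace SpinorWightmanData

variable (W : SpinorWightmanData κ) {n : ℕ}

/-- The reindexing `α ↦ α ∘ rev` of multi-indices, from the sequence `k` to the reversed sequence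
`k ∘ rev`, as an equivalence. [folklore] -/
def revMIdx (k : Fin n → κ) : W.MIdx k ≃ W.MIdx (fun j => k (Fin.rev j)) :=
  (Equiv.piCongrLeft (fun j => Fin (W.mult (k j))) Fin.revPerm).symm

/-- `revMIdx k α j = α (rev j)`. [folklore] -/
@[simp] theorem revMIdx_apply (k : Fin n → κ) (α : W.MIdx k) (j : Fin n) : W.revMIdx k α j = α (Fin.rev j) := rfl

end SpinorWightmanData

namespace IsSpinorWightmanQFT

open SpinorWightmanData

variable {W : SpinorWightmanData κ} {n : ℕ}

/-! ### Matrix actions in sum form -/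

/-- `matCLM A v α = ∑_β A_{αβ} v_β`. [folklore] -/
theorem matCLM_apply_eq_sum {ι : Type*} [Fintype ι] [DecidableEq ι] (A : Matrix ι ι ℂ) (v : ι → ℂ) (a : ι) :
    matCLM A v a = ∑ b, A a b * v b := by
  rw [matCLM_apply, Matrix.mulVec, dotProduct]

/-! ### Boost and rotation covariance of `wRelFn` in the form of `pct_core` -/

/-- **Boost covariance of the holomorphic Wightman function**:
`𝒲(B(χ) z) = (⊗ⱼ exp (χ Yⱼ)) 𝒲(z)` on `𝒯ʳₙ`. [cite: StreaterWightman1964, §4-3 eq. (4-29)] -/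
theorem wRelFn_boostN (hW : IsSpinorWightmanQFT W) (k : Fin n → κ) (χ : ℝ) {z : Fin n → Fin (3 + 1) → ℂ}
    (hz : z ∈ QuantumFieldTheory.relForwardTube 3 n) :
    hW.wRelFn k (TubeBoost.boostN χ z) =
      boostGroup (fun j => W.S (k j)) (fun j => hW.continuous_S (k j)) χ (hW.wRelFn k z) := by
  have hb : TubeBoost.boostN (χ : ℂ) z =
      fun j => lorentzActC (spinLorentz (SL2C.toSL SL2C.hMat SL2C.isGen_hMat (χ / 2))) (z j) := by
    funext j
    rw [TubeBoost.boostN_apply, TubeBoost.boost_ofReal_eq_lorentzActC, boost_two_eq_spinLorentz]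
  rw [hb, boostGroup_ofReal]
  funext α
  rw [hW.wRelFn_lorentz k _ hz α, matCLM_apply_eq_sum]
  rfl

/-- **Rotation covariance of the holomorphic Wightman function**: `𝒲(R z) = (⊗ⱼ Sⱼ(A_R)) 𝒲(z)`.
[cite: StreaterWightman1964, §4-3 eq. (4-29)] -/
theorem wRelFn_rot3N (hW : IsSpinorWightmanQFT W) (k : Fin n → κ) {z : Fin n → Fin (3 + 1) → ℂ}
    (hz : z ∈ QuantumFieldTheory.relForwardTube 3 n) :
    hW.wRelFn k (TubeBoost.rot3N z) = rotTensor (fun j => W.S (k j)) (hW.wRelFn k z) := by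
  have hr : TubeBoost.rot3N z = fun j => lorentzActC (spinLorentz SL2C.rotPi) (z j) := by
    funext j; rw [TubeBoost.rot3N_apply, lorentzActC_spinLorentz_rotPi]
  rw [hr, rotTensor]
  funext α
  rw [hW.wRelFn_lorentz k _ hz α, matCLM_apply_eq_sum]
  rfl

/-! ### The PCT-transformed holomorphic function and distribution -/

/-- **The PCT-transformed holomorphic Wightman function** `H(z)_α = 𝒲_{k∘rev}(−z_{n−1}, …, −z₀)_{α∘rev}`.
[cite: StreaterWightman1964, §4-3 Thm 4-7] -/
def pctH (hW : IsSpinorWightmanQFT W) (k : Fin n → κ) (z : Fin n → Fin (3 + 1) → ℂ) : W.MIdx k → ℂ :=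
  fun α => hW.wRelFn (fun j => k (Fin.rev j)) (negRev z) (W.revMIdx k α)

/-- **The PCT-transformed distribution** `⟪Ω, φ_{k_{n−1}α_{n−1}}(−x_{n−1}) ⋯ φ_{k₀α₀}(−x₀) Ω⟫`:
`𝒲_{k∘rev, α∘rev} ∘ negRevTest`. [cite: StreaterWightman1964, §4-3 eq. (4-19)] -/
def pctDist (hW : IsSpinorWightmanQFT W) (k : Fin n → κ) (α : W.MIdx k) : 𝓢((Fin n → SpaceTime 3), ℂ) →L[ℂ] ℂ :=
  (hW.wDist (fun j => k (Fin.rev j)) (W.revMIdx k α)).comp negRevTest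

/-- `pctH` is holomorphic on `𝒯ʳₙ`. [folklore] -/
theorem differentiableOn_pctH (hW : IsSpinorWightmanQFT W) (k : Fin n → κ) :
    DifferentiableOn ℂ (hW.pctH k) (QuantumFieldTheory.relForwardTube 3 n) := by
  refine differentiableOn_pi.2 fun α => ?_
  exact (differentiableOn_pi.1 (hW.differentiableOn_wRelFn fun j => k (Fin.rev j)) (W.revMIdx k α)).comp_negRev

/-- The components of `pctH` have the boundary values `pctDist`. [folklore] -/
theorem hasDistributionalBoundaryValue_pctH (hW : IsSpinorWightmanQFT W) (k : Fin n → κ) (α : W.MIdx k) :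
    HasDistributionalBoundaryValue (fun z => hW.pctH k z α) (hW.pctDist k α) :=
  (hW.hasDistributionalBoundaryValue_wRelFn (fun j => k (Fin.rev j)) (W.revMIdx k α)).comp_negRev
    fun z c => congrFun (hW.wRelFn_add_const (fun j => k (Fin.rev j)) z c) _

/-- The boost commutes with the PCT substitution. [folklore] -/
theorem negRev_boostN (w : ℂ) (z : Fin n → Fin (3 + 1) → ℂ) : negRev (TubeBoost.boostN w z) = TubeBoost.boostN w (negRev z) := by
  funext j; simp [negRev, TubeBoost.boost_neg]

/-- Products over the reversed sequence are products over the sequence. [folklore] -/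
theorem prod_rev_eq {M : Type*} [CommMonoid M] (g : Fin n → M) : ∏ j, g (Fin.rev j) = ∏ i, g i :=
  Fintype.prod_equiv Fin.revPerm _ _ fun _ => rfl

/-- **Boost covariance of `pctH`** with the same continued boosts as `wRelFn k`. [folklore] -/
theorem pctH_boostN (hW : IsSpinorWightmanQFT W) (k : Fin n → κ) (χ : ℝ) {z : Fin n → Fin (3 + 1) → ℂ}
    (hz : z ∈ QuantumFieldTheory.relForwardTube 3 n) :
    hW.pctH k (TubeBoost.boostN χ z) = boostGroup (fun j => W.S (k j)) (fun j => hW.continuous_S (k j)) χ (hW.pctH k z) := by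
  funext α
  simp only [pctH]
  rw [negRev_boostN, hW.wRelFn_boostN _ χ (negRev_mem_relForwardTube hz), boostGroup_ofReal, boostGroup_ofReal,
    matCLM_apply_eq_sum, matCLM_apply_eq_sum, ← (W.revMIdx k).sum_comp]
  refine Finset.sum_congr rfl fun β _ => ?_
  simp only [pctH, repTensor_apply, revMIdx_apply]
  rw [prod_rev_eq (fun i => W.S (k i) (SL2C.toSL SL2C.hMat SL2C.isGen_hMat (χ / 2)) (α i) (β i))]

/-! ### The box of weak local commutativity -/

/-- The reflection of a tensor product is the tensor product of the reflections. [folklore] -/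
theorem _root_.Literature.MathematicalPhysics.QuantumLattice.IsTensorOf.reflectConfigTest
    {G : 𝓢((Fin n → SpaceTime 3), ℂ)} {g : Fin n → 𝓢(SpaceTime 3, ℂ)} (hG : IsTensorOf G g) :
    IsTensorOf (TubeBoost.reflectConfigTest G) fun j => reflectTest (g j) := by
  intro x
  rw [TubeBoost.reflectConfigTest_apply, hG]
  rfl

/-- The PCT substitution of a tensor product is the tensor product of the reflected factors in the
reverse order. [folklore] -/
theorem _root_.Literature.MathematicalPhysics.QuantumLattice.IsTensorOf.negRevTest
    {G : 𝓢((Fin n → SpaceTime 3), ℂ)} {g : Fin n → 𝓢(SpaceTime 3, ℂ)} (hG : IsTensorOf G g) :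
    IsTensorOf (negRevTest G) fun j => reflectTest (g (Fin.rev j)) := by
  intro x
  rw [negRevTest_apply, hG, ← prod_rev_eq (fun i => g i (negRevReal x i))]
  refine Finset.prod_congr rfl fun j _ => ?_
  simp [Fin.rev_rev]

/-- **Weak local commutativity at a box of right-wedge configurations**: if the box
`{x | xⱼ ∈ Bⱼ}` lies in `𝒥⁺` and contains `x₀`, then for every compactly supported test function
`φ` supported in it, `𝒲_{k,α}(φ(−·)) = σ · 𝒲^{PCT}_{k,α}(φ)`, `σ = fermiPairSign` of the flags.
[cite: StreaterWightman1964, §4-3 Thm 4-7, eq. (4-33)] -/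
theorem wDist_reflect_eq_of_box (hW : IsSpinorWightmanQFT W) (k : Fin n → κ) {B : Fin n → Set (SpaceTime 3)}
    (hBo : ∀ j, IsOpen (B j)) {x₀ : Fin n → SpaceTime 3} (hx₀ : ∀ j, x₀ j ∈ B j)
    (hB : {x : Fin n → SpaceTime 3 | ∀ j, x j ∈ B j} ⊆ TubeBoost.rightWedgeConfigs)
    (φ : 𝓢((Fin n → SpaceTime 3), ℂ)) (hφ : HasCompactSupport (φ : (Fin n → SpaceTime 3) → ℂ))
    (hφB : tsupport (φ : (Fin n → SpaceTime 3) → ℂ) ⊆ {x | ∀ j, x j ∈ B j}) (α : W.MIdx k) :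
    hW.wDist k α (TubeBoost.reflectConfigTest φ) =
      fermiPairSign (List.ofFn fun j => W.isFermi (k j)) * hW.pctDist k α φ := by
  set σ : ℂ := fermiPairSign (List.ofFn fun j => W.isFermi (k j)) with hσ
  set L : 𝓢((Fin n → SpaceTime 3), ℂ) →L[ℂ] ℂ := (hW.wDist k α).comp TubeBoost.reflectConfigTest - σ • hW.pctDist k α
    with hL
  have hmain := clm_eq_zero_of_tsupport_subset_box L hBo ?_ φ hφ hφB
  · simpa [hL, sub_eq_zero] using hmain
  intro f G hG hloc
  -- the supports of the reflected factors are pairwise spacelike separated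
  have hsep : ∀ ⦃a b : Fin n⦄, a < b → AreSpacelikeSeparated (tsupport (reflectTest (f a) : SpaceTime 3 → ℂ))
      (tsupport (reflectTest (f b) : SpaceTime 3 → ℂ)) := by
    intro a b hab p hp q hq
    have hp' : -p ∈ B a := (hloc a).2 (tsupport_comp_subset_preimage (f a : SpaceTime 3 → ℂ) continuous_neg hp)
    have hq' : -q ∈ B b := (hloc b).2 (tsupport_comp_subset_preimage (f b : SpaceTime 3 → ℂ) continuous_neg hq)
    exact areSpacelikeSeparated_neg_of_box_subset hx₀ hB hab p hp' q hq'
  have h1 : hW.wDist k α (TubeBoost.reflectConfigTest G) = W.wightmanFn n k α fun j => reflectTest (f j) :=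
    hW.wDist_apply_of_isTensorOf k α hG.reflectConfigTest
  have h3 : hW.pctDist k α G = W.wightmanFn n (fun j => k (Fin.rev j)) (fun j => α (Fin.rev j)) fun j => reflectTest (f (Fin.rev j)) := by
    rw [pctDist, ContinuousLinearMap.comp_apply, hW.wDist_apply_of_isTensorOf _ _ hG.negRevTest]
    rfl
  rw [hL, sub_apply, ContinuousLinearMap.comp_apply, smul_apply, h1, h3,
    hW.wightmanFn_eq_fermiPairSign_mul_reverse k α _ hsep, smul_eq_mul, sub_self]

/-! ### The PCT identity of the holomorphic functions -/

/-- **The PCT identity of the holomorphic Wightman functions** (Streater–Wightman (1964), Thm. 4-7,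
eq. (4-35) in basis-free form): on the forward tube,
`𝒲_k(z) = σ · (⊗ⱼ (pctMatrixⱼ · Sⱼ(−1))) 𝒲^{PCT}_k(z)`. [cite: StreaterWightman1964, §4-3 Thm 4-7] -/
theorem wRelFn_eq_pct (hW : IsSpinorWightmanQFT W) (k : Fin n → κ) {z : Fin n → Fin (3 + 1) → ℂ} (hz : z ∈ forwardTube 3 n) :
    hW.wRelFn k z = fermiPairSign (List.ofFn fun j => W.isFermi (k j)) •
      matCLM (piMatrix fun j => SL2C.pctMatrix (W.S (k j)) (hW.continuous_S (k j)) * W.S (k j) (-1)) (hW.pctH k z) := by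
  set S : (j : Fin n) → SL(2, ℂ) →* Matrix (Fin (W.mult (k j))) (Fin (W.mult (k j))) ℂ := fun j => W.S (k j) with hS
  have hSc : ∀ j, Continuous (S j) := fun j => hW.continuous_S (k j)
  -- a box of right-wedge configurations
  obtain ⟨x₀, hx₀⟩ := TubeBoost.rightWedgeConfigs_nonempty (n := n)
  obtain ⟨ε, hε, hbox⟩ := exists_ball_box_subset_rightWedgeConfigs hx₀
  have hOo : IsOpen {x : Fin n → SpaceTime 3 | ∀ j, x j ∈ Metric.ball (x₀ j) ε} := by
    rw [show {x : Fin n → SpaceTime 3 | ∀ j, x j ∈ Metric.ball (x₀ j) ε} = Metric.ball x₀ ε by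
      rw [ball_pi _ hε]; ext x; simp]
    exact Metric.isOpen_ball
  have hOne : ({x : Fin n → SpaceTime 3 | ∀ j, x j ∈ Metric.ball (x₀ j) ε}).Nonempty :=
    ⟨x₀, fun j => Metric.mem_ball_self hε⟩
  have key := TubeBoost.pct_core_local (F := hW.wRelFn k) (H := hW.pctH k) (hW.differentiableOn_wRelFn k)
    (hW.differentiableOn_pctH k) (hW.hasDistributionalBoundaryValue_wRelFn k) (hW.hasDistributionalBoundaryValue_pctH k)
    (differentiable_boostGroup S hSc) (boostGroup_zero S hSc) (boostGroup_add S hSc)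
    (fun χ z hz => hW.wRelFn_boostN k χ hz) (fun χ z hz => hW.pctH_boostN k χ hz)
    (rotTensorInv_mul_rotTensor S) (fun z hz => hW.wRelFn_rot3N k hz) (boostGroup_mul_rotTensor S hSc)
    (fermiPairSign (List.ofFn fun j => W.isFermi (k j))) hOo hOne hbox
    (fun φ hφ hφO α => hW.wDist_reflect_eq_of_box k (fun j => Metric.isOpen_ball) (fun j => Metric.mem_ball_self hε) hbox φ hφ hφO α)
    hz
  rw [key]
  congr 1
  show (boostGroup S hSc (-(π * I)) * rotTensorInv S) (hW.pctH k z) = _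
  rw [boostGroup_neg_pi_mul_I_mul_rotTensorInv S hSc]

/-! ### The PCT identity of the distributions -/

/-- Compactly supported test functions are dense enough: a continuous linear functional vanishing on
them vanishes. [folklore] -/
theorem clm_eq_zero_of_forall_hasCompactSupport {E : Type*} [NormedAddCommGroup E] [NormedSpace ℝ E] [FiniteDimensional ℝ E]
    (L : 𝓢(E, ℂ) →L[ℂ] ℂ) (h : ∀ φ : 𝓢(E, ℂ), HasCompactSupport (φ : E → ℂ) → L φ = 0) : L = 0 := by
  ext φ
  obtain ⟨u, hu, hlim⟩ := exists_hasCompactSupport_tendsto φ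
  have h1 : Tendsto (fun m => L (u m)) atTop (𝓝 (L φ)) := (L.continuous.tendsto φ).comp hlim
  have h2 : (fun m => L (u m)) = fun _ => 0 := funext fun m => h (u m) (hu m)
  rw [h2] at h1
  exact (tendsto_nhds_unique h1 tendsto_const_nhds)

/-- **The PCT identity of the Wightman distributions, first form**:
`𝒲_{k,α} = σ ∑_β (⊗ⱼ (pctMatrixⱼ Sⱼ(−1)))_{αβ} 𝒲^{PCT}_{k,β}`. [cite: StreaterWightman1964, §4-3 Thm 4-7 eq. (4-19)] -/
theorem wDist_eq_pct' (hW : IsSpinorWightmanQFT W) (k : Fin n → κ) (α : W.MIdx k) (φ : 𝓢((Fin n → SpaceTime 3), ℂ)) :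
    hW.wDist k α φ = fermiPairSign (List.ofFn fun j => W.isFermi (k j)) *
      ∑ β : W.MIdx k, (piMatrix fun j => SL2C.pctMatrix (W.S (k j)) (hW.continuous_S (k j)) * W.S (k j) (-1)) α β * hW.pctDist k β φ := by
  set σ : ℂ := fermiPairSign (List.ofFn fun j => W.isFermi (k j)) with hσ
  set C := piMatrix fun j => SL2C.pctMatrix (W.S (k j)) (hW.continuous_S (k j)) * W.S (k j) (-1) with hC
  -- both sides are continuous in `φ`; prove it for compactly supported `φ` first
  set L : 𝓢((Fin n → SpaceTime 3), ℂ) →L[ℂ] ℂ := hW.wDist k α - σ • ∑ β : W.MIdx k, C α β • hW.pctDist k β with hL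
  suffices hL0 : L = 0 by
    have h := congrArg (fun T : 𝓢((Fin n → SpaceTime 3), ℂ) →L[ℂ] ℂ => T φ) hL0
    simp only [hL, sub_apply, zero_apply, sub_eq_zero, smul_apply, sum_apply, smul_eq_mul] at h
    exact h
  refine clm_eq_zero_of_forall_hasCompactSupport L fun ψ hψ => ?_
  -- along a ray the two boundary values are limits of equal integrals
  set η : Fin n → SpaceTime 3 := fun j => (((j : ℕ) : ℝ) + 1) • e₀ 3 with hη
  have hη' : η ∈ tubeCone 3 n := QuantumFieldTheory.stdDirection_mem_tubeCone
  have t₁ := hW.hasDistributionalBoundaryValue_wRelFn k α η hη' ψ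
  have t₃ : ∀ β, Tendsto (fun t : ℝ => ∫ x : Fin n → SpaceTime 3,
      hW.pctH k (fun j => complexifyPoint (x j) + ((t : ℂ) * I) • complexifyPoint (η j)) β * ψ x)
      (𝓝[>] 0) (𝓝 (hW.pctDist k β ψ)) := fun β => hW.hasDistributionalBoundaryValue_pctH k β η hη' ψ
  have tsum : Tendsto (fun t : ℝ => σ * ∑ β, C α β * ∫ x : Fin n → SpaceTime 3,
      hW.pctH k (fun j => complexifyPoint (x j) + ((t : ℂ) * I) • complexifyPoint (η j)) β * ψ x)
      (𝓝[>] 0) (𝓝 (σ * ∑ β, C α β * hW.pctDist k β ψ)) :=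
    (tendsto_finsetSum _ fun β _ => (t₃ β).const_mul _).const_mul σ
  have heq : ∀ t : ℝ, 0 < t → ∫ x : Fin n → SpaceTime 3,
      hW.wRelFn k (fun j => complexifyPoint (x j) + ((t : ℂ) * I) • complexifyPoint (η j)) α * ψ x =
      σ * ∑ β, C α β * ∫ x : Fin n → SpaceTime 3,
        hW.pctH k (fun j => complexifyPoint (x j) + ((t : ℂ) * I) • complexifyPoint (η j)) β * ψ x := by
    intro t ht
    have hint : ∀ β, Integrable fun x : Fin n → SpaceTime 3 =>
        hW.pctH k (fun j => complexifyPoint (x j) + ((t : ℂ) * I) • complexifyPoint (η j)) β * ψ x := fun β =>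
      ((continuous_raySlice (differentiableOn_pi.1 (hW.differentiableOn_pctH k) β) hη' ht).mul ψ.continuous).integrable_of_hasCompactSupport
        hψ.mul_left
    have e : ∀ β, C α β * ∫ x : Fin n → SpaceTime 3,
        hW.pctH k (fun j => complexifyPoint (x j) + ((t : ℂ) * I) • complexifyPoint (η j)) β * ψ x =
        ∫ x : Fin n → SpaceTime 3, C α β *
          (hW.pctH k (fun j => complexifyPoint (x j) + ((t : ℂ) * I) • complexifyPoint (η j)) β * ψ x) :=
      fun β => (integral_const_mul _ _).symm
    simp_rw [e]
    rw [← integral_finsetSum _ (fun β _ => (hint β).const_mul _), ← integral_const_mul]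
    refine integral_congr_ae (Eventually.of_forall fun x => ?_)
    have hzx : (fun j => complexifyPoint (x j) + ((t : ℂ) * I) • complexifyPoint (η j)) ∈ forwardTube 3 n :=
      mem_forwardTube_of_mem_tubeCone x η hη' ht
    have h := congrFun (hW.wRelFn_eq_pct k hzx) α
    simp only [Pi.smul_apply, smul_eq_mul] at h
    beta_reduce
    rw [h, matCLM_apply_eq_sum, Finset.mul_sum, Finset.mul_sum, Finset.sum_mul]
    refine Finset.sum_congr rfl fun β _ => ?_
    ring
  have t₁' : Tendsto (fun t : ℝ => ∫ x : Fin n → SpaceTime 3,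
      hW.wRelFn k (fun j => complexifyPoint (x j) + ((t : ℂ) * I) • complexifyPoint (η j)) α * ψ x)
      (𝓝[>] 0) (𝓝 (σ * ∑ β, C α β * hW.pctDist k β ψ)) := by
    refine tsum.congr' ?_
    filter_upwards [self_mem_nhdsWithin] with t ht
    exact (heq t ht).symm
  have hval := tendsto_nhds_unique t₁ t₁'
  simp only [hL, sub_apply, smul_apply, sum_apply, smul_eq_mul]
  rw [hval, sub_eq_zero]

/-- `Λ(−1) = 1`: the element `−1 ∈ SL(2, ℂ)` covers the identity. [cite: StreaterWightman1964, §1-3 eq. (1-25)] -/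
theorem spinCoverHom_neg_one : spinCoverHom (-1) = 1 :=
  Subtype.ext (by rw [show ((spinCoverHom (-1) : restrictedLorentzGroup 3) : SpaceTime 3 ≃L[ℝ] SpaceTime 3) = spinLorentz (-1) from rfl,
    spinLorentz_neg, spinLorentz_one]; rfl)

/-- The trivial Poincaré element acts trivially on test functions of several arguments. [folklore] -/
theorem poincareTestMulti_one (G : 𝓢((Fin n → SpaceTime 3), ℂ)) : poincareTestMulti n (1 : PoincareGroup 3) G = G := by
  ext x
  rw [poincareTestMulti_apply]
  congr 1
  funext j
  simp

/-- **A rotation by `2π` acts trivially on the PCT-transformed distributions**: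
`∑_γ (⊗ⱼ Sⱼ(−1))_{βγ} 𝒲^{PCT}_{k,γ} = 𝒲^{PCT}_{k,β}`. [cite: StreaterWightman1964, §4-3 eq. (4-32)] -/
theorem sum_repTensor_neg_one_pctDist (hW : IsSpinorWightmanQFT W) (k : Fin n → κ) (β : W.MIdx k) (φ : 𝓢((Fin n → SpaceTime 3), ℂ)) :
    ∑ γ : W.MIdx k, repTensor (fun j => W.S (k j)) (-1) β γ * hW.pctDist k γ φ = hW.pctDist k β φ := by
  have h := hW.wDist_comp_poincareTestMulti_inr (fun j => k (Fin.rev j)) (W.revMIdx k β) (-1)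
  rw [spinCoverHom_neg_one, map_one] at h
  have h' := congrArg (fun T : 𝓢((Fin n → SpaceTime 3), ℂ) →L[ℂ] ℂ => T (negRevTest φ)) h
  simp only [ContinuousLinearMap.comp_apply, poincareTestMulti_one, sum_apply, smul_apply, smul_eq_mul] at h'
  rw [pctDist, ContinuousLinearMap.comp_apply, h', ← (W.revMIdx k).sum_comp]
  refine Finset.sum_congr rfl fun γ _ => ?_
  simp only [repTensor_apply, revMIdx_apply, pctDist, ContinuousLinearMap.comp_apply]
  rw [prod_rev_eq (fun i => W.S (k i) (-1) (β i) (γ i))]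

/-- **The PCT identity of the Wightman distributions** (Streater–Wightman (1964), Thm. 4-7,
eq. (4-19), basis-free): `𝒲_{k,α} = σ ∑_β (⊗ⱼ pctMatrixⱼ)_{αβ} 𝒲^{PCT}_{k,β}`.
[cite: StreaterWightman1964, §4-3 Thm 4-7 eq. (4-19)] -/
theorem wDist_eq_pct (hW : IsSpinorWightmanQFT W) (k : Fin n → κ) (α : W.MIdx k) (φ : 𝓢((Fin n → SpaceTime 3), ℂ)) :
    hW.wDist k α φ = fermiPairSign (List.ofFn fun j => W.isFermi (k j)) *
      ∑ β : W.MIdx k, (∏ j, SL2C.pctMatrix (W.S (k j)) (hW.continuous_S (k j)) (α j) (β j)) * hW.pctDist k β φ := by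
  rw [hW.wDist_eq_pct' k α φ, piMatrix_pctMatrix_mul_neg_one]
  congr 1
  simp only [Matrix.mul_apply, Finset.sum_mul]
  rw [Finset.sum_comm]
  refine Finset.sum_congr rfl fun β _ => ?_
  simp only [mul_assoc, ← Finset.mul_sum, hW.sum_repTensor_neg_one_pctDist k β φ, piMatrix_apply]

/-- **The PCT identity on tensor products of test functions** (Streater–Wightman (1964), eq. (4-19),
smeared): `𝒲_{k,α}(f) = σ ∑_β ∏ⱼ Cⱼ(αⱼ, βⱼ) 𝒲_{k∘rev, β∘rev}(f̂ ∘ rev)`, `f̂(x) = f(−x)`,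
`Cⱼ = SL2C.pctMatrix (S (k j))`, `σ = (−1)^{F(F−1)/2}`. [cite: StreaterWightman1964, §4-3 Thm 4-7 eq. (4-19)] -/
theorem wightmanFn_eq_pct (hW : IsSpinorWightmanQFT W) (k : Fin n → κ) (α : W.MIdx k) (f : Fin n → 𝓢(SpaceTime 3, ℂ)) :
    W.wightmanFn n k α f = fermiPairSign (List.ofFn fun j => W.isFermi (k j)) *
      ∑ β : W.MIdx k, (∏ j, SL2C.pctMatrix (W.S (k j)) (hW.continuous_S (k j)) (α j) (β j)) *
        W.wightmanFn n (fun j => k (Fin.rev j)) (fun j => β (Fin.rev j)) (fun j => reflectTest (f (Fin.rev j))) := by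
  have hG := isTensorOf_tensorFin (E := SpaceTime 3) f
  rw [← hW.wDist_apply_of_isTensorOf k α hG, hW.wDist_eq_pct k α]
  congr 1
  refine Finset.sum_congr rfl fun β _ => ?_
  rw [pctDist, ContinuousLinearMap.comp_apply, hW.wDist_apply_of_isTensorOf _ _ hG.negRevTest]
  rfl

end IsSpinorWightmanQFT

end Literature.Analysis.FunctionSpaces
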